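import Mathlib
import Literature.Analysis.OperatorTheory.RieszProjectionContour
import Literature.Analysis.OperatorTheory.RieszProjectionPerturbation
import Literature.Analysis.OperatorTheory.RieszProjectionIdempotent
import Literature.Analysis.OperatorTheory.CompactNearIdentityFiniteDim
import HarnessLib

/-!
# The Riesz projection of a compact operator is compact with finite-dimensional range; the Riesz
  projection over a continuously moving circle (Kato III-§6.7 Thm. 6.26, IV-§3.4–3.5)

Analysis/OperatorTheory proofs-layer file (theorems only, no definitions, no named facts),
continuing `RieszProjectionContour.lean`, `RieszProjectionIdempotent.lean` and
`RieszProjectionPerturbation.lean`. Two groups of results about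
`rieszProjection a c r = (2πi)⁻¹ ∮_{C(c,r)} (z − a)⁻¹ dz`:

* **Compact operators** (Kato 1966, III-§6.7, Thm. 6.26 and step III of its proof). For `z ≠ 0`
  in `ρ(a)`, `(z − a)⁻¹ = z⁻¹ + a · z⁻¹ (z − a)⁻¹` (`resolvent_eq_inv_smul_one_add_mul`; Kato:
  "`R(ζ) + ζ⁻¹ = ζ⁻¹ T R(ζ)` is compact with `T`"), and `∮_{C(c,r)} z⁻¹ dz = 0` when the circle
  does not enclose the origin (`r < |c|`), so the Riesz integral factors through `a`
  (`circleIntegral_resolvent_eq_mul`, `rieszProjection_eq_mul`). Hence for a compact operator `T`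
  on a complex Banach space the Riesz projection over such a circle in `ρ(T)` is a compact
  operator (`isCompactOperator_rieszProjection`), its range — a closed subspace on which the
  compact `P` is the identity — is finite-dimensional
  (`finiteDimensional_range_rieszProjection`, via
  `finiteDimensional_of_isCompactOperator_of_norm_sub_le`), and the part of `σ(T)` inside the
  circle is a finite set of at most `dim PX` points (`exists_finset_eq_spectrum_inter_ball`,
  `finite_spectrum_inter_ball_of_isCompactOperator`): its points are non-zero eigenvalues
  (Mathlib's Fredholm alternative `IsCompactOperator.hasEigenvalue_iff_mem_spectrum`), with
  linearly independent eigenvectors (`Module.End.eigenvectors_linearIndependent`) all fixed by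
  `P` (`rieszProjection_apply_of_apply_eq_smul`).
* **Moving circles** (the form in which Kato IV-§3.4 Thm. 3.16 / §3.5 is applied along a
  parameter). A circle of positive radius in `ρ(a)` has a closed annular neighbourhood in `ρ(a)`
  (`exists_thickening_annulus_subset_resolventSet`), inside which the Riesz integral does not
  depend on the radius (`circleIntegral_resolvent_eq_of_mem_Icc`, Cauchy); by upper
  semicontinuity of the spectrum (`eventually_subset_resolventSet`) the same annulus serves all
  nearby operators, so `x ↦ rieszProjection (T x) c (ρ x)` is continuous wherever `T` and the
  radius `ρ` are (`continuousWithinAt_rieszProjection_of_radius`).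

Not here: Kato's `σ(T|PX) = Σ′` (III-§6.4 Thm. 6.17) and the count of the enclosed eigenvalues
with algebraic multiplicity; `dim PX` is only an upper bound for the number of distinct points.

## References

* T. Kato, *Perturbation Theory for Linear Operators*, Springer 1966, III-§6.7 Thm. 6.26 (held
  copy `book:kato1966-perturbation-theory-linear-operators`, chunks p0228–p0230), III-§6.4
  Thm. 6.17 (6.19), IV-§3.4 Thm. 3.16, IV-§3.5 (chunk p0260). [Kato1966]
-/

noncomputable section

open Complex MeasureTheory Metric Set Filter Topology

namespace Literature.Analysis.OperatorTheory

/-! ### The resolvent off the origin and the factorisation of the Riesz integral -/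

section Algebra

variable {A : Type*} [NormedRing A] [NormedAlgebra ℂ A]

/-- **The resolvent off the origin**: for `z ≠ 0` in the resolvent set of `a`,
`(z − a)⁻¹ = z⁻¹ • 1 + a (z⁻¹ (z − a)⁻¹)` (multiply `(z − a)(z − a)⁻¹ = 1` out; Kato 1966,
III-§6.7, proof of Thm. 6.26: "`R(ζ) + ζ⁻¹ = ζ⁻¹ T R(ζ)`", with Mathlib's sign
`resolvent a z = −R(z)`). [cite: Kato1966, III-§6.7 Thm. 6.26 (proof, step III)] -/
theorem resolvent_eq_inv_smul_one_add_mul {a : A} {z : ℂ} (hz : z ∈ resolventSet ℂ a)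
    (hz0 : z ≠ 0) : resolvent a z = z⁻¹ • (1 : A) + a * (z⁻¹ • resolvent a z) := by
  have h1 : (algebraMap ℂ A z - a) * resolvent a z = 1 := Ring.mul_inverse_cancel _ hz
  rw [Algebra.algebraMap_eq_smul_one, sub_mul, smul_mul_assoc, one_mul, sub_eq_iff_eq_add] at h1
  rw [mul_smul_comm, ← smul_add, ← h1, smul_smul, inv_mul_cancel₀ hz0, one_smul]

variable [CompleteSpace A]

/-- **The Riesz integral over a circle not enclosing the origin factors through the element**:
if the circle `|z − c| = r` lies in `ρ(a)` and `r < |c|` (so `0 ∉ {|z − c| ≤ r}`), then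
`∮_{C(c,r)} (z − a)⁻¹ dz = a ∮_{C(c,r)} z⁻¹ (z − a)⁻¹ dz`, because `∮_{C(c,r)} z⁻¹ dz = 0` by
Cauchy's theorem (Kato 1966, III-§6.7, proof of Thm. 6.26, step III: "Since `∫_Γ ζ⁻¹ dζ = 0`,
`P` is equal to the integral along `Γ` of the compact operator `R(ζ) + ζ⁻¹`").
[cite: Kato1966, III-§6.7 Thm. 6.26 (proof, step III)] -/
theorem circleIntegral_resolvent_eq_mul {a : A} {c : ℂ} {r : ℝ} (hr : 0 ≤ r)
    (hs : sphere c r ⊆ resolventSet ℂ a) (h0 : r < ‖c‖) :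
    (∮ z in C(c, r), resolvent a z) = a * ∮ z in C(c, r), z⁻¹ • resolvent a z := by
  -- `0` is outside the closed disc
  have h0' : ∀ z ∈ closedBall c r, z ≠ 0 := fun z hz hz0 => by
    rw [hz0, mem_closedBall, dist_comm, dist_zero_right] at hz
    exact absurd hz (not_le.2 h0)
  have hzs : ∀ z ∈ sphere c r, z ≠ 0 := fun z hz => h0' z (sphere_subset_closedBall hz)
  have hRc : ContinuousOn (resolvent a) (sphere c r) := (continuousOn_resolvent a).mono hs
  have hinv : ContinuousOn (fun z : ℂ => z⁻¹) (sphere c r) := fun z hz =>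
    (continuousAt_inv₀ (hzs z hz)).continuousWithinAt
  have heq : EqOn (resolvent a) (fun z => z⁻¹ • (1 : A) + a * (z⁻¹ • resolvent a z))
      (sphere c r) := fun z hz => resolvent_eq_inv_smul_one_add_mul (hs hz) (hzs z hz)
  have hi1 : CircleIntegrable (fun z : ℂ => z⁻¹ • (1 : A)) c r :=
    (hinv.smul continuousOn_const).circleIntegrable hr
  have hi2' : CircleIntegrable (fun z : ℂ => z⁻¹ • resolvent a z) c r :=
    (hinv.smul hRc).circleIntegrable hr
  have hi2 : CircleIntegrable (fun z : ℂ => a * (z⁻¹ • resolvent a z)) c r :=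
    (continuousOn_const.mul (hinv.smul hRc)).circleIntegrable hr
  -- Cauchy's theorem for `z⁻¹` on the disc
  have hC : (∮ z in C(c, r), (fun z : ℂ => z⁻¹) z) = 0 :=
    circleIntegral_eq_zero_of_differentiable_on_off_countable hr countable_empty
      (fun z hz => (continuousAt_inv₀ (h0' z hz)).continuousWithinAt)
      fun z hz => differentiableAt_inv (h0' z (ball_subset_closedBall hz.1))
  -- left multiplication by `a` commutes with the integral
  have hmul : (∮ z in C(c, r), a * (z⁻¹ • resolvent a z)) =
      a * ∮ z in C(c, r), z⁻¹ • resolvent a z := by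
    have hl := (ContinuousLinearMap.mul ℂ A a).intervalIntegral_comp_comm
      ((circleIntegrable_iff r).1 hi2')
    simp only [ContinuousLinearMap.mul_apply', mul_smul_comm] at hl
    simp only [circleIntegral, mul_smul_comm]
    exact hl
  rw [circleIntegral.integral_congr hr heq, circleIntegral.integral_add hi1 hi2,
    circleIntegral.integral_smul_const, hC, zero_smul, zero_add, hmul]

/-- Hence `rieszProjection a c r = a · ((2πi)⁻¹ ∮_{C(c,r)} z⁻¹ (z − a)⁻¹ dz)` when the circle lies
in the resolvent set and does not enclose the origin. [cite: Kato1966, III-§6.7 Thm. 6.26 (proof, step III)] -/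
theorem rieszProjection_eq_mul {a : A} {c : ℂ} {r : ℝ} (hr : 0 ≤ r)
    (hs : sphere c r ⊆ resolventSet ℂ a) (h0 : r < ‖c‖) :
    rieszProjection a c r = a * ((2 * Real.pi * I)⁻¹ • ∮ z in C(c, r), z⁻¹ • resolvent a z) := by
  rw [rieszProjection_def, circleIntegral_resolvent_eq_mul hr hs h0, mul_smul_comm]

/-! ### A thick annulus around a circle in the resolvent set; radius independence -/

/-- **A thick annulus around a circle in the resolvent set**: if the circle `|z − c| = r > 0` lies
in the (open) resolvent set of `a`, so does a closed annulus `r − κ ≤ |z − c| ≤ r + κ` with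
`0 < κ < r` (compactness of the circle: a closed `κ`-thickening of it stays in `ρ(a)`, and the
annulus lies in that thickening by radial projection). [folklore] -/
theorem exists_thickening_annulus_subset_resolventSet {a : A} {c : ℂ} {r : ℝ} (hr : 0 < r)
    (hs : sphere c r ⊆ resolventSet ℂ a) :
    ∃ κ, 0 < κ ∧ κ < r ∧ closedBall c (r + κ) \ ball c (r - κ) ⊆ resolventSet ℂ a := by
  obtain ⟨δ, hδ, hsub⟩ := (isCompact_sphere c r).exists_cthickening_subset_open
    (spectrum.isOpen_resolventSet a) hs
  refine ⟨min δ (r / 2), lt_min hδ (by linarith), (min_le_right _ _).trans_lt (by linarith),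
    fun z hz => hsub ?_⟩
  have hκδ : min δ (r / 2) ≤ δ := min_le_left _ _
  have hκr : min δ (r / 2) ≤ r / 2 := min_le_right _ _
  have hzr : r - min δ (r / 2) ≤ dist z c := not_lt.1 fun hlt => hz.2 (mem_ball.2 hlt)
  have hzr' : dist z c ≤ r + min δ (r / 2) := mem_closedBall.1 hz.1
  rw [dist_eq_norm] at hzr hzr'
  have hpos : 0 < ‖z - c‖ := by linarith
  have hnz : ‖z - c‖ ≠ 0 := hpos.ne'
  -- the radial projection of `z` onto the circle
  set p : ℂ := c + ((r / ‖z - c‖ : ℝ) : ℂ) * (z - c) with hp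
  have hpmem : p ∈ sphere c r := by
    rw [mem_sphere, dist_eq_norm, hp, add_sub_cancel_left, norm_mul, Complex.norm_real,
      Real.norm_eq_abs, abs_of_nonneg (div_nonneg hr.le (norm_nonneg _)), div_mul_cancel₀ _ hnz]
  have hdist : dist z p ≤ δ := by
    rw [dist_eq_norm, hp, show z - (c + ((r / ‖z - c‖ : ℝ) : ℂ) * (z - c)) =
      ((1 - r / ‖z - c‖ : ℝ) : ℂ) * (z - c) by push_cast; ring, norm_mul, Complex.norm_real,
      Real.norm_eq_abs, show (1 - r / ‖z - c‖ : ℝ) = (‖z - c‖ - r) / ‖z - c‖ by field_simp,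
      abs_div, abs_of_pos hpos, div_mul_cancel₀ _ hnz]
    rw [abs_sub_le_iff]
    constructor <;> linarith
  rw [Metric.mem_cthickening_iff]
  calc Metric.infEDist z (sphere c r) ≤ edist z p := Metric.infEDist_le_edist_of_mem hpmem
    _ = ENNReal.ofReal (dist z p) := (edist_dist z p)
    _ ≤ ENNReal.ofReal δ := ENNReal.ofReal_le_ofReal hdist

/-- **Radius independence inside a thick annulus**: if the closed annulus
`R − κ ≤ |z − c| ≤ R + κ` (`κ < R`) lies in `ρ(a)`, the Riesz integrals over all circles
`|z − c| = r`, `r ∈ [R − κ, R + κ]`, agree (Cauchy's theorem on an annulus,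
`circleIntegral_resolvent_eq_of_annulus`). [cite: Kato1966, III-§6.4 Thm. 6.17 (6.19)] -/
theorem circleIntegral_resolvent_eq_of_mem_Icc {a : A} {c : ℂ} {R κ : ℝ} (hκR : κ < R)
    (h : closedBall c (R + κ) \ ball c (R - κ) ⊆ resolventSet ℂ a) {r₁ r₂ : ℝ}
    (h₁ : r₁ ∈ Icc (R - κ) (R + κ)) (h₂ : r₂ ∈ Icc (R - κ) (R + κ)) :
    (∮ z in C(c, r₁), resolvent a z) = ∮ z in C(c, r₂), resolvent a z := by
  wlog h12 : r₁ ≤ r₂ generalizing r₁ r₂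
  · exact (this h₂ h₁ (le_of_not_ge h12)).symm
  exact (circleIntegral_resolvent_eq_of_annulus (by linarith [h₁.1]) h12 fun z hz =>
    h ⟨closedBall_subset_closedBall h₂.2 hz.1, fun hb => hz.2 (ball_subset_ball h₁.1 hb)⟩).symm

/-! ### The Riesz projection over a moving circle -/

/-- **The Riesz projection over a continuously moving circle is norm-continuous** (Kato 1966,
IV-§3.4 Thm. 3.16 — "`P[S]` tends to `P[T]` in norm" — combined with the radius independence of
III-§6.4, as used along a parameter in IV-§3.5): if `x ↦ T x ∈ A` and the radius `x ↦ ρ x` are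
continuous at `x₀` within `s`, `ρ x₀ > 0` and the circle `|z − c| = ρ x₀` lies in `ρ(T x₀)`, then
`x ↦ P[T x; c, ρ x]` is continuous at `x₀` within `s`. Indeed for `x` near `x₀` a fixed thick
annulus around the circle stays in `ρ(T x)` (upper semicontinuity of the spectrum) and contains
the circle of radius `ρ x`, so `P[T x; c, ρ x] = P[T x; c, ρ x₀]`, which is continuous in `x` by
Thm. 3.16. [cite: Kato1966, IV-§3.4 Thm. 3.16] -/
theorem continuousWithinAt_rieszProjection_of_radius {X : Type*} [TopologicalSpace X]
    {T : X → A} {ρ : X → ℝ} {s : Set X} {x₀ : X} {c : ℂ} (hT : ContinuousWithinAt T s x₀)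
    (hρ : ContinuousWithinAt ρ s x₀) (h0 : 0 < ρ x₀)
    (hs : sphere c (ρ x₀) ⊆ resolventSet ℂ (T x₀)) :
    ContinuousWithinAt (fun x => rieszProjection (T x) c (ρ x)) s x₀ := by
  obtain ⟨κ, hκ, hκR, hann⟩ := exists_thickening_annulus_subset_resolventSet h0 hs
  have hK : IsCompact (closedBall c (ρ x₀ + κ) \ ball c (ρ x₀ - κ)) :=
    (isCompact_closedBall _ _).diff isOpen_ball
  have h1 : ∀ᶠ x in 𝓝[s] x₀, closedBall c (ρ x₀ + κ) \ ball c (ρ x₀ - κ) ⊆ resolventSet ℂ (T x) :=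
    hT.tendsto.eventually (eventually_subset_resolventSet hK hann)
  have h2 : ∀ᶠ x in 𝓝[s] x₀, dist (ρ x) (ρ x₀) < κ := Metric.tendsto_nhds.1 hρ.tendsto κ hκ
  have h3 : (fun x => rieszProjection (T x) c (ρ x)) =ᶠ[𝓝[s] x₀]
      fun x => rieszProjection (T x) c (ρ x₀) := by
    filter_upwards [h1, h2] with x hx1 hx2
    rw [Real.dist_eq, abs_sub_lt_iff] at hx2
    rw [rieszProjection_def, rieszProjection_def, circleIntegral_resolvent_eq_of_mem_Icc
      (r₁ := ρ x) (r₂ := ρ x₀) hκR hx1 ⟨by linarith, by linarith⟩ ⟨by linarith, by linarith⟩]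
  exact ((continuousAt_rieszProjection h0.le hs).comp_continuousWithinAt hT).congr_of_eventuallyEq
    h3 rfl

end Algebra

/-! ### Compact operators: compact Riesz projection, finite-dimensional range, finite spectrum
inside the circle -/

section Operator

variable {E : Type*} [NormedAddCommGroup E] [NormedSpace ℂ E] [CompleteSpace E]

/-- **The Riesz projection of a compact operator over a circle not enclosing `0` is compact**
(it factors as `T ∘ B` with `B` bounded; Kato 1966, III-§6.7, proof of Thm. 6.26, step III:
"`P` … is itself compact"). [cite: Kato1966, III-§6.7 Thm. 6.26 (proof, step III)] -/
theorem isCompactOperator_rieszProjection {T : E →L[ℂ] E} (hT : IsCompactOperator T) {c : ℂ}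
    {r : ℝ} (hr : 0 ≤ r) (hs : sphere c r ⊆ resolventSet ℂ T) (h0 : r < ‖c‖) :
    IsCompactOperator (⇑(rieszProjection T c r : E →L[ℂ] E)) := by
  rw [rieszProjection_eq_mul hr hs h0, ContinuousLinearMap.mul_def, ContinuousLinearMap.coe_comp]
  exact hT.comp_clm _

/-- **The spectral subspace of a compact operator for a part of the spectrum away from `0` is
finite-dimensional**: the range of the Riesz projection `P` of a compact `T` over a circle in
`ρ(T)` not enclosing the origin is finite-dimensional (`P` is a compact idempotent, i.e. a compact
operator equal to the identity on its closed range `PX = ker (1 − P)`; Kato 1966, III-§6.7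
Thm. 6.26, end of proof: "In virtue of Problem 4.5, it follows that `P` is finite-dimensional").
[cite: Kato1966, III-§6.7 Thm. 6.26 (proof, step III)] -/
theorem finiteDimensional_range_rieszProjection {T : E →L[ℂ] E} (hT : IsCompactOperator T)
    {c : ℂ} {r : ℝ} (hr : 0 < r) (hs : sphere c r ⊆ resolventSet ℂ T) (h0 : r < ‖c‖) :
    FiniteDimensional ℂ (LinearMap.range (↑(rieszProjection T c r) : E →ₗ[ℂ] E)) := by
  have hP : IsIdempotentElem (rieszProjection T c r) := rieszProjection_mul_self hr hs
  refine finiteDimensional_of_isCompactOperator_of_norm_sub_le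
    (isCompactOperator_rieszProjection hT hr.le hs h0) _
    (ContinuousLinearMap.IsIdempotentElem.isClosed_range hP) zero_lt_one fun v hv => ?_
  have hv' : rieszProjection T c r v = v := by
    simpa using (LinearMap.IsIdempotentElem.mem_range_iff
      (ContinuousLinearMap.IsIdempotentElem.toLinearMap hP)).1 hv
  simp [hv']

/-- **Fredholm alternative, eigenvector form**: a non-zero spectral point of a compact operator on
a complex Banach space is an eigenvalue with a non-zero eigenvector (Mathlib's
`IsCompactOperator.hasEigenvalue_iff_mem_spectrum`; Kato III-§6.7 Thm. 6.26: "Each nonzero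
`λ ∈ Σ(T)` is an eigenvalue of `T`"). [cite: Kato1966, III-§6.7 Thm. 6.26] -/
theorem exists_eigenvector_of_mem_spectrum_of_isCompactOperator {T : E →L[ℂ] E}
    (hT : IsCompactOperator T) {μ : ℂ} (hμ : μ ∈ spectrum ℂ T) (hμ0 : μ ≠ 0) :
    ∃ v : E, v ≠ 0 ∧ T v = μ • v := by
  obtain ⟨v, hv⟩ :=
    ((IsCompactOperator.hasEigenvalue_iff_mem_spectrum hT hμ0).2 hμ).exists_hasEigenvector
  exact ⟨v, hv.2, hv.apply_eq_smul⟩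

/-- **Finitely many spectral points inside the circle, at most `dim PX`.** Let `T` be a compact
operator, `|z − c| = r > 0` a circle in `ρ(T)` with `r < |c|` and `P` its Riesz projection. Then
`σ(T) ∩ {|z − c| < r}` is a finite set with at most `dim PX` points: each such point is a non-zero
eigenvalue (Fredholm alternative), eigenvectors to distinct eigenvalues are linearly independent
(Mathlib `Module.End.eigenvectors_linearIndependent`) and lie in the finite-dimensional `PX`
(`P v = v`, Kato III-§6.5). (Kato 1966, III-§6.7 Thm. 6.26 with III-§6.5: the part of the
spectrum of a compact operator inside such a curve is a finite system of eigenvalues of total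
multiplicity `dim PX`; here only the weaker count of distinct points.) [cite: Kato1966, III-§6.7 Thm. 6.26] -/
theorem exists_finset_eq_spectrum_inter_ball {T : E →L[ℂ] E} (hT : IsCompactOperator T) {c : ℂ}
    {r : ℝ} (hr : 0 < r) (hs : sphere c r ⊆ resolventSet ℂ T) (h0 : r < ‖c‖) :
    ∃ F : Finset ℂ, (↑F : Set ℂ) = spectrum ℂ T ∩ ball c r ∧
      F.card ≤ Module.finrank ℂ (LinearMap.range (↑(rieszProjection T c r) : E →ₗ[ℂ] E)) := by
  haveI := finiteDimensional_range_rieszProjection hT hr hs h0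
  set S : Set ℂ := spectrum ℂ T ∩ ball c r with hS
  -- points of `S` are non-zero
  have hS0 : ∀ μ ∈ S, μ ≠ 0 := fun μ hμ hμ0 => by
    have h1 := mem_ball.1 hμ.2
    rw [hμ0, dist_comm, dist_zero_right] at h1
    exact absurd (h1.trans h0) (lt_irrefl _)
  -- choose eigenvectors
  have hev : ∀ μ : S, ∃ v : E, v ≠ 0 ∧ T v = (μ : ℂ) • v := fun μ =>
    exists_eigenvector_of_mem_spectrum_of_isCompactOperator hT μ.2.1 (hS0 μ μ.2)
  choose v hv0 hv using hev
  -- they are linearly independent and lie in the range of `P`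
  have hli : LinearIndependent ℂ v :=
    Module.End.eigenvectors_linearIndependent (T : Module.End ℂ E) S v fun μ =>
      ⟨Module.End.mem_eigenspace_iff.2 (hv μ), hv0 μ⟩
  have hPv : ∀ μ : S, v μ ∈ LinearMap.range (↑(rieszProjection T c r) : E →ₗ[ℂ] E) := fun μ =>
    LinearMap.mem_range.2 ⟨v μ, rieszProjection_apply_of_apply_eq_smul (hv μ) μ.2.2 hs⟩
  set W := LinearMap.range (↑(rieszProjection T c r) : E →ₗ[ℂ] E) with hW
  let w : S → W := fun μ => ⟨v μ, hPv μ⟩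
  have hw : LinearIndependent ℂ w := LinearIndependent.of_comp W.subtype hli
  have hSfin : Finite S := hw.finite
  have hfin : S.Finite := S.toFinite
  letI : Fintype S := hfin.fintype
  refine ⟨S.toFinset, S.coe_toFinset, ?_⟩
  rw [Set.toFinset_card]
  exact hw.fintype_card_le_finrank

/-- The part of the spectrum of a compact operator inside a circle in its resolvent set not
enclosing `0` is a finite set (Kato 1966, III-§6.7 Thm. 6.26: "`Σ(T)` is a countable set with no
accumulation point different from zero"). [cite: Kato1966, III-§6.7 Thm. 6.26] -/
theorem finite_spectrum_inter_ball_of_isCompactOperator {T : E →L[ℂ] E}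
    (hT : IsCompactOperator T) {c : ℂ} {r : ℝ} (hr : 0 < r)
    (hs : sphere c r ⊆ resolventSet ℂ T) (h0 : r < ‖c‖) :
    (spectrum ℂ T ∩ ball c r).Finite := by
  obtain ⟨F, hF, -⟩ := exists_finset_eq_spectrum_inter_ball hT hr hs h0
  rw [← hF]
  exact F.finite_toSet

end Operator

end Literature.Analysis.OperatorTheory

end
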